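import Literature.MathematicalPhysics.QuantumLattice.XYGriffithsBLUGroundState
import Summits.HubbardSuperconductivity.HubbardSuperconductivity.Theorems.LevyLogBootstrapHalfFilledOrderWindow
import Summits.HubbardSuperconductivity.HubbardSuperconductivity.Theorems.LevyLogBootstrapHalfFilledOrderBridge
import Summits.HubbardSuperconductivity.HubbardSuperconductivity.Theorems.LevyLogBootstrapBlock2InfDivXXZKernelCovariance
import HarnessLib

/-!
# Crux `Block2InfDivXXZ` (stmt-HubbardSuperconductivity-15048, route `LevyLogBootstrap`):
# the Griffiths–Ginibre triangle inequality for the XY torus ground-state kernel (`Δ = 0`)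

Support file (registered sub-goal `gs_transverseKernel_triangle`). Companion of
`…Block2InfDivXXZGriffithsCorner.lean`, which shows that at `M = 4` the crux follows from four
"triangle" inequalities `K(a) K(b) ≤ K(0) K(a+b)` of the SITE kernel
`K(x,y) = Re⟨ψ, S⁺_x S⁻_y ψ⟩` of the sector ground state. Here we PROVE those inequalities at the
XY point `Δ = 0`, for every even torus `M ≥ 4` and all pairwise distinct sites:

* `gs_transverseKernel_triangle` — `K(x,y) K(y,z) ≤ ½ K(x,z)` for the normalised `S³_tot = 0` sector
  ground state `ψ` of `H_M(0) = xxzHamiltonian 1 (torusGraph 2 M) (-1) 0`.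

Proof. (1) The ground state of `H_M(0)` is unique and spanned by `ψ`
(`xxzTorus_groundSpace_eq_span`: every ground vector is half filled, Perron–Frobenius in the
sector). (2) Ground-state Griffiths–Ginibre inequality of the second kind for the spin-½ XY model
(`Literature.….xy_groundState_spinX_triangle`, the `β → ∞` limit of Benassi–Lees–Ueltschi 2016,
Thm. 1, in the tree's Ginibre-doubling formalisation): `⟨SˣₓSˣᵧ⟩⟨SˣᵧSˣ_z⟩ ≤ ¼⟨SˣₓSˣ_z⟩`.
(3) On an `S³_tot` sector, `K(x,y) = 2⟨SˣₓSˣᵧ⟩` for `x ≠ y` (`re_expect_raiseLower_eq_two_mul_spinX`: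
single-site ladder operators move sectors, so `⟨S⁺S⁺⟩ = ⟨S⁻S⁻⟩ = 0`, whence `⟨SˣSˣ⟩ = ⟨SʸSʸ⟩`, and
`S⁺ₓS⁻ᵧ + S⁺ᵧS⁻ₓ = 2(SˣSˣ + SʸSʸ)`).

What this gives for the crux: with `…GriffithsCorner.lean`, a STRUCTURAL proof of the `M = 4`,
`Δ = 0` instance (modulo the finite block bookkeeping `k₂ ↦ (A, B, C)`, not done here); for
`Δ ∈ [-1, 0)` the Griffiths input is an open conjecture (numerically true on every kernel held,
`EVIDENCE-griffiths-metric-w12.md`). Also recorded: the sector lemmas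
`onSite_spinRaise_mulVec_mem` / `onSite_spinLower_mulVec_mem` (`S^±_x : 𝓗_m → 𝓗_{m±1}`) and
`expect_spinX_mul_eq_spinY_mul` (planar `U(1)` symmetry of two-point functions in a sector), which
the route's kernel files did not yet have at site level. No definition is introduced; sorry-free.
-/

noncomputable section

-- the mandated namespace `Summit.<Summit>.<Problem>.Theorems` repeats `HubbardSuperconductivity`
set_option linter.dupNamespace false

namespace Summit.HubbardSuperconductivity.HubbardSuperconductivity.Theorems.LevyLogBootstrap

open Matrix Complex
open Literature.MathematicalPhysics.QuantumLattice Literature.Probability.LatticeModels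

/-! ### Single-site ladder operators move `S³_tot` sectors -/

section SectorAlgebra

variable {Λ : Type*} [Fintype Λ] [DecidableEq Λ]

/-- `S³_tot S⁺_x = S⁺_x S³_tot + S⁺_x`: the single-site raising operator raises the total
magnetisation by one (`[S³_x, S⁺_x] = S⁺_x`, and `S³_y` commutes with `S⁺_x` for `y ≠ x`).
Tasaki (2020) §2.4, eq. (2.4.7). [folklore] -/
theorem zOn_univ_mul_onSite_spinRaise (n : ℕ) (x : Λ) :
    zOn n (Finset.univ : Finset Λ) * onSite x (spinRaise n) =
      onSite x (spinRaise n) * zOn n Finset.univ + onSite x (spinRaise n) := by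
  -- `[S³_x, S⁺_x] = S⁺_x`
  have hx : onSite x (SpinOperators.spinZ n) * onSite x (spinRaise n) -
      onSite x (spinRaise n) * onSite x (SpinOperators.spinZ n) = (onSite x (spinRaise n) : Op Λ _) := by
    have h := (isSu2Triple_on (Λ := Λ) n {x}).comm_ZP
    simpa [raiseOn, zOn, Finset.sum_singleton] using h
  -- the commutator with `S³_tot`, site by site
  have hcomm : zOn n (Finset.univ : Finset Λ) * onSite x (spinRaise n) -
      onSite x (spinRaise n) * zOn n Finset.univ = onSite x (spinRaise n) := by
    rw [zOn, Finset.sum_mul, Finset.mul_sum, ← Finset.sum_sub_distrib]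
    have hterm : ∀ y ∈ (Finset.univ : Finset Λ),
        onSite y (SpinOperators.spinZ n) * onSite x (spinRaise n) -
          onSite x (spinRaise n) * onSite y (SpinOperators.spinZ n) =
        (if y = x then onSite x (spinRaise n) else 0 : Op Λ _) := by
      intro y _
      by_cases h : y = x
      · subst h; rw [if_pos rfl, hx]
      · rw [if_neg h, onSite_mul_onSite_comm h, sub_self]
    rw [Finset.sum_congr rfl hterm, Finset.sum_ite_eq' Finset.univ x, if_pos (Finset.mem_univ x)]
  rw [sub_eq_iff_eq_add] at hcomm
  rw [hcomm]
  abel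

/-- **`S⁺_x` maps the sector `S³_tot = m` into the sector `m + 1`.** Tasaki (2020) §2.4. [folklore] -/
theorem onSite_spinRaise_mulVec_mem (n : ℕ) {m : ℝ} {v : TensorIndex Λ (n + 1) → ℂ}
    (hv : v ∈ spinZSector (Λ := Λ) n m) (x : Λ) :
    onSite x (spinRaise n) *ᵥ v ∈ spinZSector (Λ := Λ) n (m + 1) := by
  rw [mem_spinZSector_iff_mulVec] at hv ⊢
  rw [mulVec_mulVec, zOn_univ_mul_onSite_spinRaise, add_mulVec, ← mulVec_mulVec, hv,
    mulVec_smul]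
  push_cast
  rw [add_smul, one_smul]

/-- `S³_tot S⁻_x = S⁻_x S³_tot - S⁻_x`. Tasaki (2020) §2.4, eq. (2.4.7). [folklore] -/
theorem zOn_univ_mul_onSite_spinLower (n : ℕ) (x : Λ) :
    zOn n (Finset.univ : Finset Λ) * onSite x (spinLower n) =
      onSite x (spinLower n) * zOn n Finset.univ - onSite x (spinLower n) := by
  have h := congrArg conjTranspose (zOn_univ_mul_onSite_spinRaise (Λ := Λ) n x)
  rw [conjTranspose_mul, conjTranspose_add, conjTranspose_mul, zOn_conjTranspose,
    ← onSite_conjTranspose, ← spinLower_eq_conjTranspose] at h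
  -- `h : S⁻ S³ = S³ S⁻ + S⁻`
  rw [h]; abel

/-- **`S⁻_x` maps the sector `S³_tot = m` into the sector `m - 1`.** Tasaki (2020) §2.4. [folklore] -/
theorem onSite_spinLower_mulVec_mem (n : ℕ) {m : ℝ} {v : TensorIndex Λ (n + 1) → ℂ}
    (hv : v ∈ spinZSector (Λ := Λ) n m) (x : Λ) :
    onSite x (spinLower n) *ᵥ v ∈ spinZSector (Λ := Λ) n (m - 1) := by
  rw [mem_spinZSector_iff_mulVec] at hv ⊢
  rw [mulVec_mulVec, zOn_univ_mul_onSite_spinLower, sub_mulVec, ← mulVec_mulVec, hv,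
    mulVec_smul]
  push_cast
  rw [sub_smul, one_smul]

/-- In a sector vector, `⟨ψ, S⁺_x S⁺_y ψ⟩ = 0` (the image lies two sectors up). [folklore] -/
theorem expect_spinRaise_mul_spinRaise_eq_zero {m : ℝ} {ψ : TensorIndex Λ 2 → ℂ}
    (hψ : ψ ∈ spinZSector (Λ := Λ) 1 m) (x y : Λ) :
    star ψ ⬝ᵥ (onSite x (spinRaise 1) * onSite y (spinRaise 1)) *ᵥ ψ = 0 := by
  rw [← mulVec_mulVec]
  exact star_dotProduct_eq_zero_of_mem_spinZSector 1 (by linarith : m ≠ m + 1 + 1) hψ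
    (onSite_spinRaise_mulVec_mem 1 (onSite_spinRaise_mulVec_mem 1 hψ y) x)

/-- In a sector vector, `⟨ψ, S⁻_x S⁻_y ψ⟩ = 0`. [folklore] -/
theorem expect_spinLower_mul_spinLower_eq_zero {m : ℝ} {ψ : TensorIndex Λ 2 → ℂ}
    (hψ : ψ ∈ spinZSector (Λ := Λ) 1 m) (x y : Λ) :
    star ψ ⬝ᵥ (onSite x (spinLower 1) * onSite y (spinLower 1)) *ᵥ ψ = 0 := by
  rw [← mulVec_mulVec]
  exact star_dotProduct_eq_zero_of_mem_spinZSector 1 (by linarith : m ≠ m - 1 - 1) hψ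
    (onSite_spinLower_mulVec_mem 1 (onSite_spinLower_mulVec_mem 1 hψ y) x)

/-- `S⁺_x S⁺_y + S⁻_x S⁻_y = 2 (Sˣ_x Sˣ_y - Sʸ_x Sʸ_y)` (from `S^± = Sˣ ± iSʸ`). Tasaki (2020) §2.4,
eq. (2.4.6). [folklore] -/
theorem raise_raise_add_lower_lower (n : ℕ) (x y : Λ) :
    onSite x (spinRaise n) * onSite y (spinRaise n) + onSite x (spinLower n) * onSite y (spinLower n) =
      (2 : ℂ) • (siteSpin n x 0 * siteSpin n y 0) - (2 : ℂ) • (siteSpin n x 1 * siteSpin n y 1) := by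
  simp only [siteSpin, spinVec_zero, spinVec_one, spinRaise_eq_spinX_add_I_smul_spinY,
    spinLower_eq_spinX_sub_I_smul_spinY, onSite_add', onSite_sub', onSite_smul', mul_add,
    add_mul, mul_sub, sub_mul, smul_mul_assoc, mul_smul_comm, smul_add, smul_sub, smul_smul,
    Complex.I_mul_I, neg_smul, one_smul]
  module

/-- `S⁺_x S⁻_y + S⁺_y S⁻_x = 2 (Sˣ_x Sˣ_y + Sʸ_x Sʸ_y)` for `x ≠ y`. Tasaki (2020) §2.4,
eq. (2.4.6). [folklore] -/
theorem raise_lower_add_swap {x y : Λ} (hxy : x ≠ y) (n : ℕ) :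
    onSite x (spinRaise n) * onSite y (spinLower n) + onSite y (spinRaise n) * onSite x (spinLower n) =
      (2 : ℂ) • (siteSpin n x 0 * siteSpin n y 0) + (2 : ℂ) • (siteSpin n x 1 * siteSpin n y 1) := by
  simp only [siteSpin, spinVec_zero, spinVec_one, spinRaise_eq_spinX_add_I_smul_spinY,
    spinLower_eq_spinX_sub_I_smul_spinY, onSite_add', onSite_sub', onSite_smul',
    add_mul, mul_sub, smul_mul_assoc, mul_smul_comm, smul_add, smul_smul,
    Complex.I_mul_I, neg_smul, one_smul, onSite_mul_onSite_comm (Ne.symm hxy)]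
  module

/-- **Planar `U(1)` symmetry of the two-point functions in a sector**: for a vector `ψ` of a fixed
`S³_tot` sector and any sites `x, y`, `⟨ψ, Sˣ_x Sˣ_y ψ⟩ = ⟨ψ, Sʸ_x Sʸ_y ψ⟩` (their difference is
half of `⟨S⁺S⁺ + S⁻S⁻⟩ = 0`). Tasaki (2020) §2.4. [folklore] -/
theorem expect_spinX_mul_eq_spinY_mul {m : ℝ} {ψ : TensorIndex Λ 2 → ℂ}
    (hψ : ψ ∈ spinZSector (Λ := Λ) 1 m) (x y : Λ) :
    star ψ ⬝ᵥ (siteSpin 1 x 0 * siteSpin 1 y 0) *ᵥ ψ =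
      star ψ ⬝ᵥ (siteSpin 1 x 1 * siteSpin 1 y 1) *ᵥ ψ := by
  have h := congrArg (fun A : Op Λ 2 => star ψ ⬝ᵥ A *ᵥ ψ) (raise_raise_add_lower_lower (Λ := Λ) 1 x y)
  simp only [add_mulVec, sub_mulVec, smul_mulVec, dotProduct_add, dotProduct_sub, dotProduct_smul,
    expect_spinRaise_mul_spinRaise_eq_zero hψ, expect_spinLower_mul_spinLower_eq_zero hψ,
    smul_eq_mul] at h
  linear_combination (-(1 : ℂ) / 2) * h

/-- **The transverse kernel is twice the `Sˣ` two-point function**: for a sector vector `ψ` and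
`x ≠ y`, `Re⟨ψ, S⁺_x S⁻_y ψ⟩ = 2 Re⟨ψ, Sˣ_x Sˣ_y ψ⟩` (symmetrise in `x ↔ y`, expand
`S^± = Sˣ ± iSʸ`, and use `⟨SˣSˣ⟩ = ⟨SʸSʸ⟩`). Tasaki (2020) §2.4. [folklore] -/
theorem re_expect_raiseLower_eq_two_mul_spinX {m : ℝ} {ψ : TensorIndex Λ 2 → ℂ}
    (hψ : ψ ∈ spinZSector (Λ := Λ) 1 m) {x y : Λ} (hxy : x ≠ y) :
    (star ψ ⬝ᵥ (onSite x (spinRaise 1) * onSite y (spinLower 1)) *ᵥ ψ).re =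
      2 * (star ψ ⬝ᵥ (siteSpin 1 x 0 * siteSpin 1 y 0) *ᵥ ψ).re := by
  have hsym := re_expect_raiseLower_symm (Λ := Λ) 1 ψ x y
  have h := congrArg (fun A : Op Λ 2 => (star ψ ⬝ᵥ A *ᵥ ψ).re) (raise_lower_add_swap hxy 1)
  simp only [add_mulVec, smul_mulVec, dotProduct_add, dotProduct_smul, smul_eq_mul, add_re,
    ← expect_spinX_mul_eq_spinY_mul hψ x y] at h
  have h2 : ((2 : ℂ) * (star ψ ⬝ᵥ (siteSpin 1 x 0 * siteSpin 1 y 0) *ᵥ ψ)).re =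
      2 * (star ψ ⬝ᵥ (siteSpin 1 x 0 * siteSpin 1 y 0) *ᵥ ψ).re := by
    simp [Complex.mul_re]
  rw [h2] at h
  linarith

end SectorAlgebra

/-! ### The Griffiths triangle inequality for the XY torus ground-state kernel -/

section Torus

variable (M : ℕ) [NeZero M]

/-- The XY torus Hamiltonian of the crux is BLU's pair Hamiltonian with unit couplings and no
fields. [folklore] -/
theorem xxzTorus_zero_eq_xyPairField :
    xxzHamiltonian 1 (torusGraph 2 M) (-1) 0 =
      xyPairFieldHamiltonian (torusGraph 2 M) (fun _ => 1) (fun _ => 1) (fun _ => 0) (fun _ => 0) := by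
  rw [xyPairFieldHamiltonian_one_one_eq]
  simp

/-- **Registered sub-goal `gs_transverseKernel_triangle` (crux `Block2InfDivXXZ`, `Δ = 0`):
Griffiths–Ginibre triangle inequality for the transverse kernel of the XY torus ground state.**
For even `M ≥ 4`, the normalised `S³_tot = 0` sector ground state `ψ` of
`H_M(0) = xxzHamiltonian 1 (torusGraph 2 M) (-1) 0` and pairwise distinct sites `x, y, z`, the
kernel `K(x,y) = Re⟨ψ, S⁺_x S⁻_y ψ⟩` satisfies `K(x,y) K(y,z) ≤ ½ K(x,z)`, i.e. with `K(y,y) = ½`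
(translation invariance) `d = log(K(0)/K)` is subadditive: the four hypotheses (C1)–(C4) of
`block2Corner_of_siteTriangle` at `M = 4`, `Δ = 0`. Ingredients: the ground state of `H_M(0)` is
unique and spanned by `ψ` (`xxzTorus_groundSpace_eq_span`), ground-state GKS-II for the spin-½ XY
model (`xy_groundState_spinX_triangle`, Benassi–Lees–Ueltschi 2016 Thm. 1 at `β → ∞`), and
`K = 2⟨SˣSˣ⟩` on the sector (`re_expect_raiseLower_eq_two_mul_spinX`). Open for `Δ < 0`.
[cite: BenassiLeesUeltschi2016, Thm. 1] -/
theorem gs_transverseKernel_triangle (hM : Even M) (h4 : 4 ≤ M)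
    (ψ : TensorIndex (TorusSite 2 M) 2 → ℂ)
    (hψ : ψ ∈ spinZSector (Λ := TorusSite 2 M) 1 0) (hnorm : star ψ ⬝ᵥ ψ = 1)
    (heig : Matrix.mulVec (xxzHamiltonian 1 (torusGraph 2 M) (-1) 0) ψ =
      ((lowestEnergyInSector 1 (xxzHamiltonian 1 (torusGraph 2 M) (-1) 0) 0 : ℝ) : ℂ) • ψ)
    {x y z : TorusSite 2 M} (hxy : x ≠ y) (hyz : y ≠ z) (hxz : x ≠ z) :
    (star ψ ⬝ᵥ (onSite x (spinRaise 1) * onSite y (spinLower 1)) *ᵥ ψ).re *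
        (star ψ ⬝ᵥ (onSite y (spinRaise 1) * onSite z (spinLower 1)) *ᵥ ψ).re ≤
      1 / 2 * (star ψ ⬝ᵥ (onSite x (spinRaise 1) * onSite z (spinLower 1)) *ᵥ ψ).re := by
  set H : Op (TorusSite 2 M) 2 := xxzHamiltonian 1 (torusGraph 2 M) (-1) 0 with hHdef
  obtain ⟨φ, hφ0, -, hspan, hEsec⟩ := xxzTorus_groundSpace_eq_span M hM h4 (le_refl (0 : ℝ))
  have hψG : ψ ∈ H.groundSpace := by
    rw [mem_groundSpace_iff, ← hEsec]; exact heig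
  have hU : H.HasUniqueGroundState := by
    change Module.finrank ℂ H.groundSpace = 1
    rw [hspan]
    exact finrank_span_singleton hφ0
  rw [hHdef, xxzTorus_zero_eq_xyPairField] at hψG hU
  have hG := xy_groundState_spinX_triangle (torusGraph 2 M) (K₀ := fun _ => 1) (K₁ := fun _ => 1)
    (h₀ := fun _ => 0) (h₁ := fun _ => 0) (fun _ => zero_le_one) (fun _ => zero_le_one)
    (fun _ => le_rfl) (fun _ => le_rfl) hU hψG hnorm x y z
  rw [re_expect_raiseLower_eq_two_mul_spinX hψ hxy, re_expect_raiseLower_eq_two_mul_spinX hψ hyz,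
    re_expect_raiseLower_eq_two_mul_spinX hψ hxz]
  nlinarith [hG]

end Torus

/-- **Registered sub-goal `gs_transverseKernel_triangle_all` (crux `Block2InfDivXXZ`,
stmt-HubbardSuperconductivity-15048)**: the `∀`-closed form of `gs_transverseKernel_triangle` — at the
XY point `Δ = 0`, for every even torus `M ≥ 4`, every normalised `S³_tot = 0` sector ground state and
all pairwise distinct sites, `K(x,y) K(y,z) ≤ ½ K(x,z)`. [cite: BenassiLeesUeltschi2016, Thm. 1] -/
theorem gs_transverseKernel_triangle_all :
    ∀ (M : ℕ) [NeZero M], Even M → 4 ≤ M → ∀ (ψ : TensorIndex (TorusSite 2 M) 2 → ℂ),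
      ψ ∈ @spinZSector (TorusSite 2 M) _ _ 1 0 → star ψ ⬝ᵥ ψ = 1 →
      Matrix.mulVec (xxzHamiltonian 1 (torusGraph 2 M) (-1) 0) ψ =
        ((lowestEnergyInSector 1 (xxzHamiltonian 1 (torusGraph 2 M) (-1) 0) 0 : ℝ) : ℂ) • ψ →
      ∀ x y z : TorusSite 2 M, x ≠ y → y ≠ z → x ≠ z →
        (star ψ ⬝ᵥ Matrix.mulVec (onSite x (spinRaise 1) * onSite y (spinLower 1)) ψ).re *
            (star ψ ⬝ᵥ Matrix.mulVec (onSite y (spinRaise 1) * onSite z (spinLower 1)) ψ).re ≤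
          1 / 2 * (star ψ ⬝ᵥ Matrix.mulVec (onSite x (spinRaise 1) * onSite z (spinLower 1)) ψ).re :=
  fun M _ hM h4 ψ hψ hnorm heig _ _ _ hxy hyz hxz =>
    gs_transverseKernel_triangle M hM h4 ψ hψ hnorm heig hxy hyz hxz

end Summit.HubbardSuperconductivity.HubbardSuperconductivity.Theorems.LevyLogBootstrap

end
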